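import Literature.MathematicalPhysics.QuantumFieldTheory.Balaban1983to89.T4TiltModulus
import Literature.MathematicalPhysics.QuantumFieldTheory.Balaban1983to89.T4FibreTranslate

/-!
# T4CondLawRelative — the model conditional law `condLaw s old V` in RELATIVE fibre coordinates: the change of
# variables `y = y′·V_Λ⌈_s` (right invariance of the normalised Haar fibres) as a kernel identity, and the tilt modulus
# of `T4TiltModulus` posed in the coordinates in which Bałaban's windows are exterior-blind
# (cell `pub-balaban`, lineage pv04 = one-writer of `T4DressingDefect.condLaw`; self-row T4-O3.E-i-α-RELCOORD*; kernel
# answer to the cross-reading question (x4)/(c1) of `t4/T4-EST-O3Ei1.md` v1.4 §4d, GAPS G-pv16g9-2; bookkeeping)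

HONEST FRAMING (cell `pub-balaban`, T4-DAG v10).  The cell's T4 target is the existence AND uniqueness of the continuum
limit of Bałaban's unit-scale averaged loop expectations on a finite torus — NOT the Yang–Mills mass gap, NOT the Clay
problem.  This module settles ONE located question about the cell's OWN model and proves ELEMENTARY MEASURE THEORY,
nothing else.  The question ((x4) of the cross-reading `t4/T4-XREAD` item C-t4l-27, caveat (c1) of GAPS G-pv16g9-2,
put to this lineage as the owner of `T4DressingDefect.condLaw`): *in which coordinates does the model conditional law
`condLaw s old V` ("`E_t[· | V_out]`") read its fibre variable — the RAW bond variables `V⌈_Λ`, or Bałaban's fluctuation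
RELATIVE to an exterior-dependent background, `V′ = V_k(V_Λ)⁻¹` / `V′ = V(V^{(k)})⁻¹`?*  ANSWER, by definition
(`T4DressingDefect.fibreLaw`, `condLaw`, `fibreVar`, `condMean`): the RAW ones — the fibre coordinate `y : s → G` enters as
`updateFinset V s y` against the product of the normalised Haar measures; the module `T4DressingDefect` is
reading-agnostic (the integrated density `old`, the reference map `ref` and every insert are consumer-supplied).  Hence
caveat (c1) is correct as stated: `T4TiltModulus.FibreRatioClose s old u u₀` compares the fibre densities `y ↦ old(u←y)`,
`y ↦ old(u₀←y)` at the SAME raw `y`, which forces equal zero sets, and a window restricting the relative variable `V′`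
alone is NOT exterior-blind in `y` (`relWindow_updateFinset` below: it reads `y·(V_Λ(u)⌈_s)⁻¹`).  WHAT IS PROVED is the
bridge between the two readings, a change of variables and nothing more: because every Haar fibre measure is RIGHT
INVARIANT, for ANY background field functional `vΛ` that does not depend on the integrated variables
(`T4FibreTranslate.FieldIndep s vΛ`, the hypothesis SHAPE the text gives `V_Λ` / `V^{(k)}`) the raw-coordinate law is the
push-forward of the relative-coordinate law — the SAME model `condLaw s · V` applied to the RELATIVE DENSITY
`relDensity s vΛ old : U ↦ old(U ·_s vΛ(U))` (the printed integrand read as a function of `V′`) — under the fibre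
translation `y′ ↦ y′·(vΛ V)⌈_s` (§2: `map_fibreLaw_relDensity`, `map_condLaw_relDensity`, `integral_condLaw_eq_relative`,
`condMean_relDensity`, `dTerm_eq_relative`; total-mass case = `T4FibreTranslate.fibreIntegral_translateOn_of_fieldIndep` BY
NAME).  Consequently every THEOREM about `condLaw` / `condMean` / `dTerm` in the tree holds verbatim in either reading, and
the tilt modulus (T3) of `T4TiltModulus` can be POSED IN RELATIVE COORDINATES (§3, `norm_integral_condLaw_sub_le_relative`):
ratio-closeness is required of the relative fibre densities (`FibreRatioClose s (relDensity s vΛ old) u u₀ κ ε`) — there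
a window reading `V′` alone IS exterior-blind (`relWindow_updateFinset_mul`, `fibreRatioClose_relWindow_exp`) — and the
price is the additional (B-INS)-type term `D ≥ sup_{y′} ‖F(y′·vΛ(u)⌈_s) − F(y′·vΛ(u₀)⌈_s)‖`: in relative coordinates an
exterior-independent insert is read through the moving background.  Both `ε` and `D` are INPUTS here.

WHAT IS NOT CLAIMED.  Nothing printed by Bałaban is asserted or used: not that the minimisers `V_Λ = M^k(U₀)` ([IV]
p. 197) / `V^{(k)} = Ū^k_{k+1} = M^k(U_{k+1})` ([I] (2.3) p. 265) exist, are unique, measurable or independent of the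
integrated variables (B12/B15-side inputs of the DAG, U1a); not that any printed density is of the Gibbs form of §3;
no estimate of the oscillation `ε(u)` (the (LOG) caveat, GAPS G-pv28g6-1′, pv28's `T4TiltOscillation`) or of the
background variation `D`; the δ-function factors of the printed laws stay outside the density model (DIVERGENCE F7 /
D-f2.8 / D-pv16.2 / D-pv16.5).  Value = kernel certificate of a change of variables deciding in which coordinates (S-TILT) is to be posed,
NOT summit progress.

CITATION HEADER (lean-in-tree rule 2026-08-18).  T. Bałaban, *Renormalization group approach to lattice gauge field
theories. I*, Comm. Math. Phys. **109**, 249–301 (1987) [Balaban1987RG1] (cell paper B12 = [I]; held text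
`paper:balaban1987-cmp109-rg-i-small-field`, journal page = PDF page + 248); T. Bałaban, *Large field renormalization. I.
The basic step of the 𝐑 operation*, Comm. Math. Phys. **122**, 175–202 (1989) [Balaban1989LargeFieldI] (B15 = [IV]; held
`paper:balaban1989-cmp122-large-field-i`, journal page = PDF page + 174); T. Bałaban, *Large field renormalization. II*,
Comm. Math. Phys. **122**, 355–392 (1989) [Balaban1989LargeFieldII] (B16 = [V]; held `paper:balaban1989-cmp122-large-field-ii`,
journal page = PDF page + 354).  All three are manuscripts UNDER ADJUDICATION by the audit cell; they are quoted for the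
SHAPE of a change of variables only («…» checked against the held texts, `lit read … --grep`), never as facts.

WHAT IS PRINTED (the shape only).
* [I] p. 265 (held text p0017): «We introduce new integration variables V′ = V(V^{(k)})^{−1}, or V = V′V^{(k)}, and we
  assume that the characteristic function χ_k and the δ-functions in (2.1) restrict the variables B′ = (1/i) log V′ to a
  sufficiently small neighborhood of 0.»; p. 266 (p0018): «The variables Ṽ′(y, x) = (V′V^{(k)})(y, x)(V^{(k)}(y, x))^{−1}
  have an expansion of the form Ṽ′(y, x) = 1 + B̃′(y, x) + …, where B̃′(y, x) is a linear function»; and (2.9) p. 266: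
  «χ_k = Π_{b∈T^{(k)}∖{b₀(c): c∈T^{(k+1)}} χ({|B′(b)| < ε₁})».
* [V] p. 378 (held text p0024): «These bounds and the axial gauge conditions for V′_k = V_k(V_Λ)^{−1} imply the bound
  (1.83) [IV] for V′_k».
* [IV] (1.100)–(1.102) p. 201 (held text p0027): the `i`-th quotient of the basic large-field step integrates
  `dV′⌈_{Λ_i}` with the window (1.101) «χ(Λ_i) = χ({|(1/i) log V′(b)| < M₀ε_k for b ∈ Λ_i})» and has «the fundamental
  normalization property ∫dV_k(ℝ′ρ_k)(V_k) = ∫dV_k ρ_k(V_k)» (1.102) — the change of variables typed for SCALAR fibre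
  integrals in `T4FibreTranslate` (b01), which this module lifts to the fibre MEASURES of `T4DressingDefect`.

DICTIONARY.  `s : Finset (PBond P j)` = the integrated bond variables (`Λ`, `Λ_i`); `V u u₀ : GaugeField P j G` = the whole
field (fibre + exterior); `vΛ : GaugeField → GaugeField` with `FieldIndep s vΛ` = the background `V_Λ` / `V^{(k)}` as a
functional of the exterior variables; `onFibre s W : s → G` = `W⌈_s`; `y : s → G` = RAW fibre coordinates (`V⌈_s`),
`y′` = RELATIVE ones (`V′⌈_s`), `y = y′ * onFibre s (vΛ V)` (bondwise right multiplication, [I] «V = V′V^{(k)}»);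
`relDensity s vΛ old U = old (translateOn s U (vΛ U))` = the density read in the relative variable; `relWindow s vΛ w U =
w (b ↦ U(b)·(vΛ U (b))⁻¹)` = a window reading `V′⌈_s` alone (the shape of (1.101) [IV] / of `χ_k` in [I] p. 265).

CONTENTS (every declaration [folklore]; Mathlib + `T4DressingDefect` (pv04-g5), `T4TiltModulus` (pv16-g9), `T4FibreTranslate`
(b01) BY NAME).
* §1 generic: push-forward of a weighted law `ν.withDensity (ρ ∘ e)` and of the normalised law `normLaw ν (p ∘ e)` under a
  measurable equivalence `e` preserving `ν` (`map_withDensity_comp_equiv`, `map_normLaw_comp_equiv`,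
  `integral_normLaw_comp_equiv`).
* §2 the change of fibre coordinates for `fibreLaw` / `condLaw` / `condMean` / `dTerm` (`map_fibreLaw_relDensity`,
  `map_condLaw_relDensity`, `integral_condLaw_eq_relative`, `condMean_relDensity`, `dTerm_eq_relative`), the raw reading as
  the instance `vΛ ≡ 1` (`relDensity_one`), and the relative window (`relWindow_updateFinset`, `relWindow_updateFinset_mul`).
* §3 the tilt modulus of `condLaw` with ratio-closeness IN RELATIVE COORDINATES (`norm_integral_condLaw_sub_le_relative`)
  and its Gibbs-form supplier with a relative window (`fibreRatioClose_relDensity_of_exp`, `fibreRatioClose_relWindow_exp`).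

v1.1 (this file): DOCFIX over v1 (p182861) from the cross-read XREAD C-pv05g10-2 (pv05-g10, renders read as images):
module docstring only — D1 the minimiser notation `V^{(k)} = Ū^k_{k+1} = M^k(U_{k+1})` ([I] (2.3), superscript k),
D2 the tilde restored in the [I] p. 266 quotation («1 + B̃′(y, x) + …, where B̃′(y, x) is a linear function»), R1 the
explicit window formula [I] (2.9) added here and in the `relWindow` docstring.  No declaration, statement or proof changed.

Depends on `T4DressingDefect` (`fibreLaw`, `condLaw`, `condMean`, `dTerm`, `fibreVar`, `isProbabilityMeasure_condLaw`),
`T4TiltModulus` (`normLaw`, `fibreBase`, `fibreDensity`, `FibreRatioClose`, `condLaw_eq_normLaw`, `measurable_fibreDensity`,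
`integral_fibreDensity_pos`, `norm_integral_normLaw_sub_le`, `norm_integral_sub_integral_le_of_insert`, `ratioClose_of_exp`),
`T4FibreTranslate` (`translateOn`, `FieldIndep`, `haar_isMulRightInvariant`, `fibreIntegral_translateOn_of_fieldIndep`),
`T4CoReadMoment` (`integrable_of_abs_le`) and Mathlib (`MeasurableEquiv.mulRight`, `Measure.map_mul_right_eq_self`,
`Measure.pi.isMulRightInvariant`, `measurePreserving_mul_right`, `integral_mul_right_eq_self`, `lintegral_map_equiv`,
`integral_map_equiv`, `MeasurableEquiv.restrict_map`, `withDensity_apply`, `memLp_top_of_bound`).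
-/

open scoped BigOperators ENNReal
open _root_.MeasureTheory Function Finset

namespace Literature.MathematicalPhysics.QuantumFieldTheory.Balaban1983to89.T4CondLawRelative

open B15.BasicStep T4DressedR T4DressingDefect T4FibreTranslate T4TiltModulus

/-! ## §1 Generic: push-forward of a weighted / normalised law under a base-preserving measurable equivalence -/

section Abstract

variable {S : Type*} [MeasurableSpace S] {ν : Measure S}

/-- CHANGE OF VARIABLES FOR A WEIGHTED LAW: if the measurable equivalence `e` preserves `ν`, the push-forward under `e` of
`ν` weighted by `ρ ∘ e` is `ν` weighted by `ρ`. [folklore] -/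
theorem map_withDensity_comp_equiv (e : S ≃ᵐ S) (hν : ν.map e = ν) (ρ : S → ℝ≥0∞) :
    (ν.withDensity fun x => ρ (e x)).map e = ν.withDensity ρ := by
  ext A hA
  rw [e.map_apply, withDensity_apply _ (e.measurable hA), withDensity_apply _ hA]
  conv_rhs => rw [← hν, e.restrict_map, lintegral_map_equiv]

/-- … in particular the total masses agree. [folklore] -/
theorem withDensity_comp_equiv_univ (e : S ≃ᵐ S) (hν : ν.map e = ν) (ρ : S → ℝ≥0∞) :
    (ν.withDensity fun x => ρ (e x)) Set.univ = ν.withDensity ρ Set.univ := by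
  rw [← map_withDensity_comp_equiv e hν ρ, e.map_apply, Set.preimage_univ]

/-- CHANGE OF VARIABLES FOR THE NORMALISED LAW `normLaw ν p = (∫p dν)⁻¹·p dν` of `T4TiltModulus`: the push-forward under a
`ν`-preserving measurable equivalence `e` of `normLaw ν (p ∘ e)` is `normLaw ν p`. [folklore] -/
theorem map_normLaw_comp_equiv (e : S ≃ᵐ S) (hν : ν.map e = ν) (p : S → ℝ) :
    (normLaw ν fun x => p (e x)).map e = normLaw ν p := by
  have h1 := map_withDensity_comp_equiv e hν (fun x => ENNReal.ofReal (p x))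
  have h2 := withDensity_comp_equiv_univ e hν (fun x => ENNReal.ofReal (p x))
  simp only [normLaw, Measure.map_smul]
  rw [h1, h2]

/-- … hence integrals against `normLaw ν p` are integrals of the transported integrand against `normLaw ν (p ∘ e)`.
[folklore] -/
theorem integral_normLaw_comp_equiv {E : Type*} [NormedAddCommGroup E] [NormedSpace ℝ E] (e : S ≃ᵐ S)
    (hν : ν.map e = ν) (p : S → ℝ) (F : S → E) :
    ∫ x, F x ∂normLaw ν p = ∫ x, F (e x) ∂normLaw ν (fun x => p (e x)) := by
  rw [← map_normLaw_comp_equiv e hν p, integral_map_equiv]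

end Abstract

/-! ## §2 The change of fibre coordinates `y = y′·(vΛ V)⌈_s` for `fibreLaw` / `condLaw` / `condMean` / `dTerm` -/

section Fibre

variable {P : Params} {j : ℕ} {G : Type*} [GaugeGroup G] [MeasurableSpace G] [HaarData G]
variable [DecidableEq (PBond P j)]

omit [MeasurableSpace G] [HaarData G] [DecidableEq (PBond P j)] in
/-- Restriction of a field to the fibre index type: `onFibre s W = W⌈_s`. [folklore] -/
def onFibre (s : Finset (PBond P j)) (W : GaugeField P j G) : s → G := fun b => W b

omit [GaugeGroup G] [MeasurableSpace G] [HaarData G] [DecidableEq (PBond P j)] in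
/-- `onFibre s W b = W b`. [folklore] -/
@[simp] theorem onFibre_apply (s : Finset (PBond P j)) (W : GaugeField P j G) (b : s) : onFibre s W b = W b := rfl

/-- THE RELATIVE DENSITY: the density `old` read in the relative fibre variable, `U ↦ old(U ·_s vΛ(U))` — at
`U = (V′ on s, exterior elsewhere)` this is the printed integrand evaluated at `V = V′V^{(k)}` / `V′_kV_{Λ_i}`.
[cite: Balaban1987RG1, p.265] -/
def relDensity (s : Finset (PBond P j)) (vΛ : GaugeField P j G → GaugeField P j G) (old : Density P j G) :
    Density P j G :=
  fun U => old (translateOn s U (vΛ U))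

omit [MeasurableSpace G] [HaarData G] in
/-- Unfolding lemma for the relative density. [folklore] -/
theorem relDensity_apply (s : Finset (PBond P j)) (vΛ : GaugeField P j G → GaugeField P j G) (old : Density P j G)
    (U : GaugeField P j G) : relDensity s vΛ old U = old (translateOn s U (vΛ U)) := rfl

omit [MeasurableSpace G] [HaarData G] in
/-- Pointwise bounds transport to the relative density (lower). [folklore] -/
theorem relDensity_nonneg (s : Finset (PBond P j)) (vΛ : GaugeField P j G → GaugeField P j G) {old : Density P j G}
    (h0 : ∀ U, 0 ≤ old U) (U : GaugeField P j G) : 0 ≤ relDensity s vΛ old U := h0 _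

omit [MeasurableSpace G] [HaarData G] in
/-- Pointwise bounds transport to the relative density (upper). [folklore] -/
theorem relDensity_le (s : Finset (PBond P j)) (vΛ : GaugeField P j G → GaugeField P j G) {old : Density P j G}
    {C : ℝ} (hC : ∀ U, old U ≤ C) (U : GaugeField P j G) : relDensity s vΛ old U ≤ C := hC _

omit [MeasurableSpace G] [HaarData G] in
/-- THE RAW READING IS THE INSTANCE `vΛ ≡ 1`: with the trivial background the relative density is the density. [folklore] -/
theorem relDensity_one (s : Finset (PBond P j)) (old : Density P j G) : relDensity s (fun _ => 1) old = old := by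
  funext U
  rw [relDensity_apply]
  congr 1
  funext b
  by_cases hb : b ∈ s
  · rw [translateOn, if_pos hb]; exact mul_one (U b)
  · rw [translateOn, if_neg hb]

omit [MeasurableSpace G] [HaarData G] in
/-- Translating the fibre variables of an updated field = updating with the translated fibre coordinates:
`(V←y′) ·_s W = V←(y′·W⌈_s)`. [folklore] -/
theorem translateOn_updateFinset (s : Finset (PBond P j)) (V W : GaugeField P j G) (y : s → G) :
    translateOn s (updateFinset V s y) W = updateFinset V s (y * onFibre s W) := by
  funext b
  by_cases hb : b ∈ s
  · simp only [translateOn, if_pos hb, updateFinset, dif_pos hb, Pi.mul_apply, onFibre]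
  · simp only [translateOn, if_neg hb, updateFinset, dif_neg hb]

omit [MeasurableSpace G] [HaarData G] in
/-- THE RELATIVE DENSITY ON THE FIBRE THROUGH `V`: `relDensity(V←y′) = old(V←y′·vΛ(V)⌈_s)` for a background independent of
the fibre variables. [folklore] -/
theorem relDensity_updateFinset (s : Finset (PBond P j)) {vΛ : GaugeField P j G → GaugeField P j G}
    (hv : FieldIndep s vΛ) (old : Density P j G) (V : GaugeField P j G) (y : s → G) :
    relDensity s vΛ old (updateFinset V s y) = old (updateFinset V s (y * onFibre s (vΛ V))) := by
  rw [relDensity_apply, hv V y, translateOn_updateFinset]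

omit [MeasurableSpace G] [HaarData G] in
/-- … i.e. the fibre density (`T4TiltModulus.fibreDensity`) of the relative density is the fibre density of `old` composed
with the fibre translation `y′ ↦ y′·vΛ(V)⌈_s`. [folklore] -/
theorem fibreDensity_relDensity (s : Finset (PBond P j)) {vΛ : GaugeField P j G → GaugeField P j G}
    (hv : FieldIndep s vΛ) (old : Density P j G) (V : GaugeField P j G) :
    fibreDensity s (relDensity s vΛ old) V = fun y => fibreDensity s old V (y * onFibre s (vΛ V)) := by
  funext y
  simp only [fibreDensity, relDensity_updateFinset s hv]

/-- A WINDOW READING THE RELATIVE VARIABLE ALONE: `U ↦ w(U⌈_s · (vΛ U)⌈_s⁻¹)` — the shape of (1.101) [IV]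
«χ({|(1/i) log V′(b)| < M₀ε_k for b ∈ Λ_i})» with `V′ = V_k(V_Λ)⁻¹`, and of `χ_k` restricting `B′ = (1/i) log V′` in [I]
p. 265, (2.9) p. 266 «χ_k = Π_{b∈T^{(k)}∖{b₀(c): c∈T^{(k+1)}} χ({|B′(b)| < ε₁})» (single-bond windows in the relative
variable).  Nothing is asserted about the printed windows. [cite: Balaban1989LargeFieldI, (1.101) p.201] -/
def relWindow (s : Finset (PBond P j)) (vΛ : GaugeField P j G → GaugeField P j G) (w : (s → G) → ℝ) :
    Density P j G :=
  fun U => w fun b : s => U b * (vΛ U b)⁻¹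

omit [MeasurableSpace G] [HaarData G] in
/-- IN RAW COORDINATES the relative window MOVES WITH THE EXTERIOR through the background: on the fibre through `u` it reads
`y ↦ w(y·(vΛ u)⌈_s⁻¹)` — caveat (c1) of GAPS G-pv16g9-2 made literal. [folklore] -/
theorem relWindow_updateFinset (s : Finset (PBond P j)) {vΛ : GaugeField P j G → GaugeField P j G}
    (hv : FieldIndep s vΛ) (w : (s → G) → ℝ) (u : GaugeField P j G) (y : s → G) :
    relWindow s vΛ w (updateFinset u s y) = w (fun b : s => y b * (vΛ u b)⁻¹) := by
  unfold relWindow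
  rw [hv u y]
  congr 1
  funext b
  simp only [updateFinset, dif_pos b.2, Subtype.coe_eta]

omit [MeasurableSpace G] [HaarData G] in
/-- IN RELATIVE COORDINATES the relative window is EXTERIOR-BLIND: `relWindow(u←y′·vΛ(u)⌈_s) = w(y′)` for every exterior
`u`. [folklore] -/
theorem relWindow_updateFinset_mul (s : Finset (PBond P j)) {vΛ : GaugeField P j G → GaugeField P j G}
    (hv : FieldIndep s vΛ) (w : (s → G) → ℝ) (u : GaugeField P j G) (y : s → G) :
    relWindow s vΛ w (updateFinset u s (y * onFibre s (vΛ u))) = w y := by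
  rw [relWindow_updateFinset s hv]
  congr 1
  funext b
  rw [Pi.mul_apply, onFibre_apply, mul_inv_cancel_right]

variable [MeasurableMul G]

omit [DecidableEq (PBond P j)] in
/-- The fibre translation `y′ ↦ y′·B` preserves the base law `fibreBase s` (product of the normalised Haar measures; right
invariance, `T4FibreTranslate.haar_isMulRightInvariant` + Mathlib `Measure.pi.isMulRightInvariant`). [folklore] -/
theorem map_mulRight_fibreBase (s : Finset (PBond P j)) (B : s → G) :
    (fibreBase (P := P) (j := j) s).map (fun y => y * B) = fibreBase s :=
  map_mul_right_eq_self _ B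

omit [DecidableEq (PBond P j)] in
/-- … as a `MeasurePreserving` statement. [folklore] -/
theorem measurePreserving_mulRight_fibreBase (s : Finset (PBond P j)) (B : s → G) :
    MeasurePreserving (fun y : s → G => y * B) (fibreBase (P := P) (j := j) s) (fibreBase s) :=
  measurePreserving_mul_right _ B

/-- **THE CHANGE OF FIBRE COORDINATES FOR THE FIBRE LAW.**  For a background `vΛ` independent of the fibre variables, the
fibre law of `old` through `V` (raw coordinates) is the push-forward of the fibre law of the relative density through `V`
(relative coordinates) under `y′ ↦ y′·vΛ(V)⌈_s`. [folklore] -/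
theorem map_fibreLaw_relDensity (s : Finset (PBond P j)) {vΛ : GaugeField P j G → GaugeField P j G}
    (hv : FieldIndep s vΛ) (old : Density P j G) (V : GaugeField P j G) :
    (fibreLaw s (relDensity s vΛ old) V).map (fun y => y * onFibre s (vΛ V)) = fibreLaw s old V := by
  have hν : (fibreBase (P := P) (j := j) s).map (MeasurableEquiv.mulRight (onFibre s (vΛ V))) = fibreBase s := by
    rw [MeasurableEquiv.coe_mulRight]; exact map_mulRight_fibreBase s _
  have h := map_withDensity_comp_equiv (MeasurableEquiv.mulRight (onFibre s (vΛ V))) hν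
    (fun y => ENNReal.ofReal (old (updateFinset V s y)))
  simp only [MeasurableEquiv.coe_mulRight] at h
  have h1 : fibreLaw s (relDensity s vΛ old) V
      = (fibreBase s).withDensity fun y => ENNReal.ofReal (old (updateFinset V s (y * onFibre s (vΛ V)))) := by
    simp only [fibreLaw, fibreBase, relDensity_updateFinset s hv]
  have h2 : fibreLaw s old V = (fibreBase s).withDensity fun y => ENNReal.ofReal (old (updateFinset V s y)) := rfl
  rw [h1, h2]
  exact h

/-- … in particular the total masses agree (this is `T4FibreTranslate.fibreIntegral_translateOn_of_fieldIndep` at the level of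
`ℝ≥0∞`-masses). [folklore] -/
theorem fibreLaw_relDensity_univ (s : Finset (PBond P j)) {vΛ : GaugeField P j G → GaugeField P j G}
    (hv : FieldIndep s vΛ) (old : Density P j G) (V : GaugeField P j G) :
    fibreLaw s (relDensity s vΛ old) V Set.univ = fibreLaw s old V Set.univ := by
  rw [← map_fibreLaw_relDensity s hv old V, Measure.map_apply (measurable_mul_const _) MeasurableSet.univ,
    Set.preimage_univ]

/-- The real fibre integrals agree — `T4FibreTranslate.fibreIntegral_translateOn_of_fieldIndep` BY NAME. [folklore] -/
theorem fibreIntegral_relDensity (s : Finset (PBond P j)) {vΛ : GaugeField P j G → GaugeField P j G}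
    (hv : FieldIndep s vΛ) (old : Density P j G) (V : GaugeField P j G) :
    fibreIntegral s (relDensity s vΛ old) V = fibreIntegral s old V :=
  fibreIntegral_translateOn_of_fieldIndep s hv old V

/-- **THE CHANGE OF FIBRE COORDINATES FOR THE CONDITIONAL LAW `E_t[· | V_out]`:** `condLaw s old V` is the push-forward of
`condLaw s (relDensity s vΛ old) V` under `y′ ↦ y′·vΛ(V)⌈_s`. [folklore] -/
theorem map_condLaw_relDensity (s : Finset (PBond P j)) {vΛ : GaugeField P j G → GaugeField P j G}
    (hv : FieldIndep s vΛ) (old : Density P j G) (V : GaugeField P j G) :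
    (condLaw s (relDensity s vΛ old) V).map (fun y => y * onFibre s (vΛ V)) = condLaw s old V := by
  rw [condLaw, condLaw, Measure.map_smul, map_fibreLaw_relDensity s hv, fibreLaw_relDensity_univ s hv]

/-- **INTEGRATION AGAINST THE CONDITIONAL LAW IN EITHER READING:** `∫F d(condLaw s old V) = ∫ F(y′·vΛ(V)⌈_s)
d(condLaw s (relDensity s vΛ old) V)(y′)` for every Banach-space-valued insert `F` (no measurability or integrability
needed: both sides carry the same junk value). [folklore] -/
theorem integral_condLaw_eq_relative {E : Type*} [NormedAddCommGroup E] [NormedSpace ℝ E] (s : Finset (PBond P j))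
    {vΛ : GaugeField P j G → GaugeField P j G} (hv : FieldIndep s vΛ) (old : Density P j G) (V : GaugeField P j G)
    (F : (s → G) → E) :
    ∫ y, F y ∂condLaw s old V = ∫ y, F (y * onFibre s (vΛ V)) ∂condLaw s (relDensity s vΛ old) V := by
  rw [← map_condLaw_relDensity s hv old V]
  exact integral_map_equiv (MeasurableEquiv.mulRight (onFibre s (vΛ V))) F

/-- THE CONDITIONAL MEAN IS READING-INVARIANT when density AND insert are both read in the relative variable:
`condMean s (relDensity old) (relDensity F) V = condMean s old F V`. [folklore] -/
theorem condMean_relDensity (s : Finset (PBond P j)) {vΛ : GaugeField P j G → GaugeField P j G}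
    (hv : FieldIndep s vΛ) (old F : Density P j G) (V : GaugeField P j G) :
    condMean s (relDensity s vΛ old) (relDensity s vΛ F) V = condMean s old F V := by
  rw [condMean, condMean, integral_condLaw_eq_relative s hv old V (fun y => F (updateFinset V s y))]
  simp only [relDensity_updateFinset s hv]

/-- THE D-TERM IN RELATIVE COORDINATES: `D_t(V_out) = log ∫ e^{t(F(V←y′·vΛ(V)⌈_s) − F(ref V))} d(condLaw s (relDensity old) V)(y′)`.
[folklore] -/
theorem dTerm_eq_relative (s : Finset (PBond P j)) {vΛ : GaugeField P j G → GaugeField P j G} (hv : FieldIndep s vΛ)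
    (old F : Density P j G) (ref : GaugeField P j G → GaugeField P j G) (V : GaugeField P j G) (t : ℝ) :
    dTerm s old F ref V t = ProbabilityTheory.cgf
      (fun y : s → G => F (updateFinset V s (y * onFibre s (vΛ V))) - F (ref V)) (condLaw s (relDensity s vΛ old) V) t := by
  simp only [dTerm, fibreVar, ProbabilityTheory.cgf, ProbabilityTheory.mgf]
  rw [integral_condLaw_eq_relative s hv old V (fun y => Real.exp (t * (F (updateFinset V s y) - F (ref V))))]

/-! ## §3 The tilt modulus of `condLaw` with ratio-closeness posed in RELATIVE coordinates -/

/-- **(T3-rel) THE TILT MODULUS OF THE CONDITIONAL LAW, RATIO-CLOSENESS IN RELATIVE COORDINATES.**  For a measurable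
integrated density `0 ≤ old ≤ C` with the printed proviso at the reference exterior `u₀`, a background `vΛ` independent of the
fibre variables, RELATIVE fibre densities ratio-close with free constant `κ` and oscillation `ε`
(`FibreRatioClose s (relDensity s vΛ old) u u₀ κ ε`), and an insert `F` on the fibre, a.e.-strongly measurable for the base
law, with `‖F − c‖ ≤ M` and background variation `‖F(y′·vΛ(u)⌈_s) − F(y′·vΛ(u₀)⌈_s)‖ ≤ D`:
`‖∫F ∂condLaw s old u − ∫F ∂condLaw s old u₀‖ ≤ (e^{2ε} − 1)·M + D`.  Both `ε` and `D` are INPUTS. [folklore] -/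
theorem norm_integral_condLaw_sub_le_relative {E : Type*} [NormedAddCommGroup E] [NormedSpace ℝ E] [CompleteSpace E]
    (s : Finset (PBond P j)) {vΛ : GaugeField P j G → GaugeField P j G} (hv : FieldIndep s vΛ) {old : Density P j G}
    (hm : Measurable old) (h0 : ∀ U, 0 ≤ old U) {C : ℝ} (hC : ∀ U, old U ≤ C) {u u₀ : GaugeField P j G}
    (hne : fibreIntegral s old u₀ ≠ 0) {κ ε : ℝ} (hR : FibreRatioClose s (relDensity s vΛ old) u u₀ κ ε)
    {F : (s → G) → E} (hF : AEStronglyMeasurable F (fibreBase s)) {c : E} {M D : ℝ} (hM : ∀ y, ‖F y - c‖ ≤ M)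
    (hD : ∀ y, ‖F (y * onFibre s (vΛ u)) - F (y * onFibre s (vΛ u₀))‖ ≤ D) :
    ‖(∫ y, F y ∂condLaw s old u) - ∫ y, F y ∂condLaw s old u₀‖ ≤ (Real.exp (2 * ε) - 1) * M + D := by
  rw [integral_condLaw_eq_relative s hv old u F, integral_condLaw_eq_relative s hv old u₀ F]
  have h0' : ∀ U, 0 ≤ relDensity s vΛ old U := relDensity_nonneg s vΛ h0
  have hC' : ∀ U, relDensity s vΛ old U ≤ C := relDensity_le s vΛ hC
  have hne' : fibreIntegral s (relDensity s vΛ old) u₀ ≠ 0 := by rwa [fibreIntegral_relDensity s hv]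
  haveI := isProbabilityMeasure_condLaw s hC' u₀ hne'
  have hσ : ∀ B : s → G, MeasurePreserving (fun y : s → G => y * B) (fibreBase (P := P) (j := j) s) (fibreBase s) :=
    fun B => measurePreserving_mulRight_fibreBase s B
  have hpm : ∀ w : GaugeField P j G, Measurable (fibreDensity s (relDensity s vΛ old) w) := fun w => by
    rw [fibreDensity_relDensity s hv]
    exact (measurable_fibreDensity s hm w).comp (measurable_mul_const _)
  have hpi : ∀ w : GaugeField P j G, Integrable (fibreDensity s (relDensity s vΛ old) w) (fibreBase s) := fun w =>
    T4CoReadMoment.integrable_of_abs_le (hpm w).aestronglyMeasurable (C := C) fun y => by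
      rw [fibreDensity, abs_of_nonneg (h0' _)]; exact hC' _
  have hZ : 0 < ∫ y, fibreDensity s (relDensity s vΛ old) u₀ y ∂fibreBase s :=
    calc (0 : ℝ) < ∫ y, fibreDensity s old u₀ y ∂fibreBase s := integral_fibreDensity_pos s hm h0 hC hne
      _ = ∫ y, fibreDensity s old u₀ (y * onFibre s (vΛ u₀)) ∂fibreBase s :=
          (integral_mul_right_eq_self (μ := fibreBase (P := P) (j := j) s) (fibreDensity s old u₀) _).symm
      _ = ∫ y, fibreDensity s (relDensity s vΛ old) u₀ y ∂fibreBase s := by rw [fibreDensity_relDensity s hv]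
  have hmod : ‖(∫ y, F (y * onFibre s (vΛ u)) ∂condLaw s (relDensity s vΛ old) u)
      - ∫ y, F (y * onFibre s (vΛ u)) ∂condLaw s (relDensity s vΛ old) u₀‖ ≤ (Real.exp (2 * ε) - 1) * M := by
    rw [condLaw_eq_normLaw, condLaw_eq_normLaw]
    exact norm_integral_normLaw_sub_le (hpm u) (hpm u₀) (fun y => h0' _) (hpi u) (hpi u₀) hZ hR
      (hF.comp_measurePreserving (hσ _)) (fun y => hM _)
  have hac : condLaw s (relDensity s vΛ old) u₀ ≪ fibreBase s := by
    rw [condLaw_eq_normLaw, normLaw]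
    exact (withDensity_absolutelyContinuous _ _).smul_left _
  have hbd : ∀ y, ‖F y‖ ≤ M + ‖c‖ := fun y =>
    calc ‖F y‖ = ‖(F y - c) + c‖ := by rw [sub_add_cancel]
      _ ≤ ‖F y - c‖ + ‖c‖ := norm_add_le _ _
      _ ≤ M + ‖c‖ := by linarith [hM y]
  have hint : ∀ B : s → G, Integrable (fun y : s → G => F (y * B)) (condLaw s (relDensity s vΛ old) u₀) := fun B =>
    (memLp_top_of_bound ((hF.comp_measurePreserving (hσ B)).mono_ac hac) (M + ‖c‖)
      (ae_of_all _ fun y => hbd _)).integrable le_top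
  exact norm_integral_sub_integral_le_of_insert hmod (hint _) (hint _) hD

omit [MeasurableSpace G] [HaarData G] [MeasurableMul G] in
/-- (T3-rel) THE GIBBS-FORM SUPPLIER IN RELATIVE COORDINATES: for `old = χ·e^{h}` with a window `χ ≥ 0` that is
exterior-blind IN THE RELATIVE VARIABLE (`χ(u←y′·vΛ(u)⌈_s) = χ(u₀←y′·vΛ(u₀)⌈_s)`) and an exponent increment oscillating by
`≤ ε` about `κ` along the relative fibre, the relative fibre densities are ratio-close.  Both hypotheses are INPUTS
((S-TILT), (LOG)). [folklore] -/
theorem fibreRatioClose_relDensity_of_exp (s : Finset (PBond P j)) {vΛ : GaugeField P j G → GaugeField P j G}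
    (hv : FieldIndep s vΛ) {χ h : Density P j G} (hχ0 : ∀ U, 0 ≤ χ U) {u u₀ : GaugeField P j G} {κ ε : ℝ}
    (hχ : ∀ y : s → G,
      χ (updateFinset u s (y * onFibre s (vΛ u))) = χ (updateFinset u₀ s (y * onFibre s (vΛ u₀))))
    (hh : ∀ y : s → G,
      |h (updateFinset u s (y * onFibre s (vΛ u))) - h (updateFinset u₀ s (y * onFibre s (vΛ u₀))) - κ| ≤ ε) :
    FibreRatioClose s (relDensity s vΛ fun U => χ U * Real.exp (h U)) u u₀ κ ε := by
  intro y
  simp only [fibreDensity, relDensity_updateFinset s hv]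
  rw [hχ y]
  exact ratioClose_of_exp (w := fun y => χ (updateFinset u₀ s (y * onFibre s (vΛ u₀))))
    (h₁ := fun y => h (updateFinset u s (y * onFibre s (vΛ u))))
    (h₂ := fun y => h (updateFinset u₀ s (y * onFibre s (vΛ u₀)))) (fun y => hχ0 _) hh y

omit [MeasurableSpace G] [HaarData G] [MeasurableMul G] in
/-- … and with a window READING THE RELATIVE VARIABLE ALONE (`relWindow`, the printed shape) the window hypothesis holds by
construction: only the oscillation of the exponent along the relative fibre is required. [folklore] -/
theorem fibreRatioClose_relWindow_exp (s : Finset (PBond P j)) {vΛ : GaugeField P j G → GaugeField P j G}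
    (hv : FieldIndep s vΛ) {w : (s → G) → ℝ} (hw : ∀ y, 0 ≤ w y) {h : Density P j G} {u u₀ : GaugeField P j G}
    {κ ε : ℝ} (hh : ∀ y : s → G,
      |h (updateFinset u s (y * onFibre s (vΛ u))) - h (updateFinset u₀ s (y * onFibre s (vΛ u₀))) - κ| ≤ ε) :
    FibreRatioClose s (relDensity s vΛ fun U => relWindow s vΛ w U * Real.exp (h U)) u u₀ κ ε :=
  fibreRatioClose_relDensity_of_exp s hv (χ := relWindow s vΛ w) (h := h) (fun U => hw _)
    (fun y => by rw [relWindow_updateFinset_mul s hv, relWindow_updateFinset_mul s hv]) hh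

end Fibre

end Literature.MathematicalPhysics.QuantumFieldTheory.Balaban1983to89.T4CondLawRelative
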